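import Mathlib
import Summits.Parity.GeneralizedHardyLittlewood.Theorems.FordMaynardSieveConst01651SieveConst01651TypeIICoeffs
import Literature.NumberTheory.Sieve.FriedlanderIwaniecPrimesThresholdSeparation
import Literature.NumberTheory.Sieve.FriedlanderIwaniecPrimesCutoffSeparation

/-!
# Route `FordMaynardSieveConst01651`, target `SieveConst01651` (stmt-Parity-19185), line `sieve_decomposition`:
# helpers towards `stub_typeIIRegion` — lifting a `τ`-weighted bilinear bound to TUPLE-indexed kernels

Ford–Maynard separate the cross conditions of (eq:sieve-final) at the MULTILINEAR level (Lemmas 7.9–7.11, 7.13)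
and only then apply (II) with the tuple coefficients `∑_{n = n₁⋯n_l} ∏ υⱼ(nⱼ)` (bounded by `τ_l(n) ≤ τ(n)^{l-1}`,
Lemma 7.7).  In the tree's `BilinBoundedBy` currency this is ONE lemma, because `BilinBoundedBy K W Z X` is generic
in the index types: a bound for the `τ(n)^{B'}`-weighted integer kernel yields the SAME bound for the kernel
`(m, t) ↦ K(m, ∏ᵢ tᵢ)` indexed by `m ∈ W` and TUPLES `t ∈ ⋃_{n ∈ Z} {t : ∏ tᵢ = n}` (`B' ≥ l - 1`), with
ARBITRARY `1`-bounded tuple coefficients `c(t)` — not only products `∏ υⱼ(tⱼ)`.  Consequently the separation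
transformers (`BilinBoundedBy.threshold`, `…ShellSeparation.bilin_threshold_shell`, `bilin_thresholds_shell`,
`bilin_threshold_of_neg_le`, `.cutoff`, `.twist`) may be applied to conditions `[B(m) < A(t)]` that read the whole
factorisation tuple `t` of the long variable (polytope conditions on `(log pᵢ / log n)`, `u m₂ ≤ √n`, block
conditions of (7.12)), exactly as in the printed proof, and the shell counts are taken over pairs `(m, t)`.

* `norm_sum_finMulAntidiag_le_rpow` — `|∑_{∏ t = n} c(t)| ≤ τ(n)^{B}` for `1`-bounded `c`, `B ≥ max(l-1, 0)`.
* `pairwiseDisjoint_finMulAntidiag` — the tuple sets of distinct products are disjoint.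
* `bilin_tupleLift` — the lift.

Def-free. Nothing here proves anything about the Parity summit; helpers for the Type-II region stub of one leaf.
-/

open Finset Literature.NumberTheory.Sieve.FriedlanderIwaniecPrimes

namespace Summit.Parity.GeneralizedHardyLittlewood.FordMaynardSieveConst01651SieveConst01651

/-- `|∑_{∏ t = n} c(t)| ≤ τ(n)^B` for ANY `1`-bounded tuple coefficients `c` and real `B ≥ max(l - 1, 0)`
(Lemma 7.7: the number of tuples is `τ_l(n) ≤ τ(n)^{l-1}`). [cite: FordMaynard2024PrimeSieves, Lemma 7.7] -/
theorem norm_sum_finMulAntidiag_le_rpow {l : ℕ} (c : (Fin l → ℕ) → ℂ) (hc : ∀ t, ‖c t‖ ≤ 1) {B : ℝ}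
    (hB0 : 0 ≤ B) (hBl : (l : ℝ) - 1 ≤ B) (n : ℕ) :
    ‖∑ t ∈ Nat.finMulAntidiag l n, c t‖ ≤ (n.divisors.card : ℝ) ^ B := by
  rcases eq_or_ne n 0 with rfl | hn
  · simp only [Nat.finMulAntidiag_zero_right, Finset.sum_empty, norm_zero]
    exact Real.rpow_nonneg (Nat.cast_nonneg _) _
  have hτ1 : (1 : ℝ) ≤ (n.divisors.card : ℝ) := by
    exact_mod_cast Finset.card_pos.mpr ⟨1, Nat.one_mem_divisors.mpr hn⟩
  calc ‖∑ t ∈ Nat.finMulAntidiag l n, c t‖ ≤ ∑ t ∈ Nat.finMulAntidiag l n, ‖c t‖ := norm_sum_le _ _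
    _ ≤ ∑ _t ∈ Nat.finMulAntidiag l n, (1 : ℝ) := Finset.sum_le_sum fun t _ => hc t
    _ = ((Nat.finMulAntidiag l n).card : ℝ) := by simp
    _ ≤ ((n.divisors.card ^ (l - 1) : ℕ) : ℝ) := by exact_mod_cast card_finMulAntidiag_le_pow l hn
    _ = (n.divisors.card : ℝ) ^ (((l - 1 : ℕ) : ℝ)) := by rw [Nat.cast_pow, Real.rpow_natCast]
    _ ≤ (n.divisors.card : ℝ) ^ B := by
        refine Real.rpow_le_rpow_of_exponent_le hτ1 ?_
        rcases l with _ | l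
        · simpa using hB0
        · rw [Nat.add_sub_cancel]
          push_cast at hBl
          linarith

/-- The tuple sets `{t : ∏ tᵢ = n}` of distinct `n` are disjoint. [folklore] -/
theorem pairwiseDisjoint_finMulAntidiag (l : ℕ) (Z : Finset ℕ) :
    (Z : Set ℕ).PairwiseDisjoint (fun n => Nat.finMulAntidiag l n) := by
  intro n₁ _ n₂ _ hne
  rw [Function.onFun, Finset.disjoint_left]
  intro t h₁ h₂
  rw [Nat.mem_finMulAntidiag] at h₁ h₂
  exact hne (h₁.1.symm.trans h₂.1)

/-- **Tuple lift of a `τ`-weighted bilinear bound.** If every bilinear form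
`∑_{m ∈ W} ∑_{n ∈ Z} a(m) b(n) τ(n)^{B'} K(m,n)` with `|a|, |b| ≤ 1` is `≤ X` and `B' ≥ max(l - 1, 0)`, then every
bilinear form `∑_{m ∈ W} ∑_{t : ∏ tᵢ ∈ Z} a(m) c(t) K(m, ∏ tᵢ)` with `|a|, |c| ≤ 1` — `c` an ARBITRARY function of
the tuple — is `≤ X`: group the tuples by their product and use `|∑_{∏ t = n} c(t)| ≤ τ(n)^{B'}`.
(So conditions reading the factorisation tuple of the long variable can be separated inside `BilinBoundedBy`.)
[cite: FordMaynard2024PrimeSieves, proof of Proposition 7.22 (display (eq:sieve-final)) and Lemma 7.7] -/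
theorem bilin_tupleLift {K : ℕ → ℕ → ℂ} {W Z : Finset ℕ} {X B' : ℝ}
    (h : BilinBoundedBy (fun m n => (((n.divisors.card : ℝ) ^ B' : ℝ) : ℂ) * K m n) W Z X)
    (hB'0 : 0 ≤ B') {l : ℕ} (hl : (l : ℝ) - 1 ≤ B') :
    BilinBoundedBy (fun m (t : Fin l → ℕ) => K m (∏ i, t i)) W
      (Z.biUnion fun n => Nat.finMulAntidiag l n) X := by
  intro a c ha hc
  -- the grouped coefficients `b(n) = (∑_{∏ t = n} c t) / τ(n)^{B'}`
  set Y : ℕ → ℂ := fun n => ∑ t ∈ Nat.finMulAntidiag l n, c t with hY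
  set b : ℕ → ℂ := fun n => if n = 0 then 0 else Y n / (((n.divisors.card : ℝ) ^ B' : ℝ) : ℂ) with hb
  have hτpos : ∀ n : ℕ, n ≠ 0 → (0 : ℝ) < (n.divisors.card : ℝ) ^ B' := fun n hn =>
    Real.rpow_pos_of_pos (by exact_mod_cast Finset.card_pos.mpr ⟨1, Nat.one_mem_divisors.mpr hn⟩) _
  have hb1 : ∀ n, ‖b n‖ ≤ 1 := by
    intro n
    simp only [hb]
    split_ifs with hn
    · simp
    · rw [norm_div, Complex.norm_real, Real.norm_of_nonneg (hτpos n hn).le, div_le_one (hτpos n hn)]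
      exact norm_sum_finMulAntidiag_le_rpow c hc hB'0 hl n
  have hmain := h a b ha hb1
  -- regroup the tuple sum by the product
  have hregroup : ∑ m ∈ W, ∑ t ∈ Z.biUnion (fun n => Nat.finMulAntidiag l n), a m * c t * K m (∏ i, t i) =
      ∑ m ∈ W, ∑ n ∈ Z, a m * b n * ((((n.divisors.card : ℝ) ^ B' : ℝ) : ℂ) * K m n) := by
    refine Finset.sum_congr rfl fun m _ => ?_
    rw [Finset.sum_biUnion (pairwiseDisjoint_finMulAntidiag l Z)]
    refine Finset.sum_congr rfl fun n _ => ?_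
    -- on `{∏ t = n}` the kernel is `K m n`
    have hK : ∀ t ∈ Nat.finMulAntidiag l n, a m * c t * K m (∏ i, t i) = a m * K m n * c t := by
      intro t ht
      rw [(Nat.mem_finMulAntidiag.mp ht).1]; ring
    rw [Finset.sum_congr rfl hK, ← Finset.mul_sum]
    rcases eq_or_ne n 0 with rfl | hn
    · simp [hb, Nat.finMulAntidiag_zero_right]
    · have hτ : ((((n.divisors.card : ℝ) ^ B' : ℝ) : ℂ)) ≠ 0 := by exact_mod_cast (hτpos n hn).ne'
      simp only [hb, hY, if_neg hn]
      field_simp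
  rw [hregroup]
  exact hmain

/-- The plain case `B' = 0`, `l ≤ 1` is pointless; the useful unweighted corollary is for kernels already carrying
the divisor weight: if `BilinBoundedBy (τ(m)^{B'} τ(n)^{B'} K) W Z X` then
`BilinBoundedBy ((m, t) ↦ τ(m)^{B'} K(m, ∏ tᵢ)) W {t : ∏ tᵢ ∈ Z} X` (`B' ≥ max(l - 1, 0)`) — the form produced by
`…TypeIIBilin.bilinBoundedBy_of_typeII`. [cite: FordMaynard2024PrimeSieves, proof of Proposition 7.22] -/
theorem bilin_tupleLift' {K : ℕ → ℕ → ℂ} {W Z : Finset ℕ} {X B' : ℝ}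
    (h : BilinBoundedBy (fun m n => (((m.divisors.card : ℝ) ^ B' : ℝ) : ℂ) *
      (((n.divisors.card : ℝ) ^ B' : ℝ) : ℂ) * K m n) W Z X)
    (hB'0 : 0 ≤ B') {l : ℕ} (hl : (l : ℝ) - 1 ≤ B') :
    BilinBoundedBy (fun m (t : Fin l → ℕ) => (((m.divisors.card : ℝ) ^ B' : ℝ) : ℂ) * K m (∏ i, t i)) W
      (Z.biUnion fun n => Nat.finMulAntidiag l n) X := by
  have h' : BilinBoundedBy (fun m n => (((n.divisors.card : ℝ) ^ B' : ℝ) : ℂ) *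
      ((((m.divisors.card : ℝ) ^ B' : ℝ) : ℂ) * K m n)) W Z X :=
    h.congr fun m _ n _ => by ring
  exact bilin_tupleLift (K := fun m n => (((m.divisors.card : ℝ) ^ B' : ℝ) : ℂ) * K m n) h' hB'0 hl

/-! ### Lifting on the SHORT side: fibres of bounded size over the Type-II variable -/

/-- **Fibre lift on the short variable.** If every bilinear form in `c(w) · K(w, z)` over `W × Z` with `1`-bounded
coefficients is `≤ X` (`c ≥ 0` on `W`, e.g. `c = τ(m)^{B'}` from (II)), and `F w` is a finite set of "decorations"
of `w` with `#F(w) ≤ c(w)` on `W` (e.g. the divisors `u₁ ∣ m` of the short block, `τ(m) ≤ τ(m)^{B'}`), then every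
bilinear form in the kernel `((w, s), z) ↦ K(w, z)` over `{(w, s) : w ∈ W, s ∈ F w} × Z` with `1`-bounded
coefficients is `≤ X`: sum the coefficient over the fibre first. (So a divisor of the Type-II variable may be
carried in the short index when a cutoff such as `u m₂ ≤ √n` involves it.) [cite: FordMaynard2024PrimeSieves, §1 (II)
(divisor-bounded coefficients) and proof of Proposition 7.22] -/
theorem bilin_fiberLift {ι₀ σ κ : Type*} [DecidableEq ι₀] [DecidableEq σ] {K : ι₀ → κ → ℂ} {W : Finset ι₀}
    {Z : Finset κ} {X : ℝ} (c : ι₀ → ℝ) (hc : ∀ w ∈ W, 0 ≤ c w)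
    (h : BilinBoundedBy (fun w z => ((c w : ℝ) : ℂ) * K w z) W Z X) (F : ι₀ → Finset σ)
    (hF : ∀ w ∈ W, ((F w).card : ℝ) ≤ c w) :
    BilinBoundedBy (fun (p : ι₀ × σ) z => K p.1 z) (W.biUnion fun w => (F w).image fun s => (w, s)) Z X := by
  classical
  intro a b ha hb
  -- fibre sums of the coefficient are `≤ c`
  have hsum_le : ∀ w ∈ W, ‖∑ s ∈ F w, a (w, s)‖ ≤ c w := by
    intro w hw
    calc ‖∑ s ∈ F w, a (w, s)‖ ≤ ∑ s ∈ F w, ‖a (w, s)‖ := norm_sum_le _ _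
      _ ≤ ∑ _s ∈ F w, (1 : ℝ) := Finset.sum_le_sum fun s _ => ha _
      _ = ((F w).card : ℝ) := by simp
      _ ≤ c w := hF w hw
  -- normalised fibre-summed coefficients
  set a₀ : ι₀ → ℂ := fun w =>
    if w ∈ W ∧ c w ≠ 0 then (∑ s ∈ F w, a (w, s)) / ((c w : ℝ) : ℂ) else 0 with ha₀
  have ha₀1 : ∀ w, ‖a₀ w‖ ≤ 1 := by
    intro w
    simp only [ha₀]
    split_ifs with hw
    · have hcpos : 0 < c w := lt_of_le_of_ne (hc w hw.1) (Ne.symm hw.2)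
      rw [norm_div, Complex.norm_real, Real.norm_of_nonneg hcpos.le, div_le_one hcpos]
      exact hsum_le w hw.1
    · simp
  have hmain := h a₀ b ha₀1 hb
  -- `a₀ w · c w = ∑_s a (w, s)` on `W`
  have hkey : ∀ w ∈ W, a₀ w * ((c w : ℝ) : ℂ) = ∑ s ∈ F w, a (w, s) := by
    intro w hw
    simp only [ha₀]
    by_cases h0 : c w = 0
    · have hF0 : F w = ∅ := by
        have := hF w hw
        rw [h0] at this
        exact Finset.card_eq_zero.mp (by exact_mod_cast le_antisymm this (Nat.cast_nonneg _))
      simp [hw, h0, hF0]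
    · have hc0 : ((c w : ℝ) : ℂ) ≠ 0 := by exact_mod_cast h0
      rw [if_pos ⟨hw, h0⟩, div_mul_cancel₀ _ hc0]
  -- regroup the sum over the fibred index set
  have hdisj : (W : Set ι₀).PairwiseDisjoint fun w => (F w).image fun s => (w, s) := by
    intro w₁ _ w₂ _ hne
    rw [Function.onFun, Finset.disjoint_left]
    intro p hp₁ hp₂
    obtain ⟨s₁, _, rfl⟩ := Finset.mem_image.mp hp₁
    obtain ⟨s₂, _, h₂⟩ := Finset.mem_image.mp hp₂
    exact hne (Prod.mk.inj h₂).1.symm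
  have hregroup : ∑ p ∈ W.biUnion (fun w => (F w).image fun s => (w, s)), ∑ z ∈ Z, a p * b z * K p.1 z =
      ∑ w ∈ W, ∑ z ∈ Z, a₀ w * b z * (((c w : ℝ) : ℂ) * K w z) := by
    rw [Finset.sum_biUnion hdisj]
    refine Finset.sum_congr rfl fun w hw => ?_
    rw [Finset.sum_image (fun s₁ _ s₂ _ heq => (Prod.mk.inj heq).2)]
    simp only
    rw [Finset.sum_comm]
    refine Finset.sum_congr rfl fun z _ => ?_
    rw [← Finset.sum_mul, ← Finset.sum_mul, ← hkey w hw]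
    ring
  rw [hregroup]
  exact hmain

end Summit.Parity.GeneralizedHardyLittlewood.FordMaynardSieveConst01651SieveConst01651
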